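import Summits.BirchSwinnertonDyer.BirchSwinnertonDyer.Theorems.SignedLowerHalvesSmallImageLowerHalfBothSignsRttCharRoadE1AwayCores
import Summits.BirchSwinnertonDyer.BirchSwinnertonDyer.Theorems.SignedLowerHalvesSmallImageLowerHalfBothSignsRttCharRoadE1InertiaRange
import Summits.BirchSwinnertonDyer.BirchSwinnertonDyer.Theorems.SignedLowerHalvesSmallImageLowerHalfBothSignsRttCharRoadE1LocalSquareLayer
import Summits.BirchSwinnertonDyer.BirchSwinnertonDyer.Theorems.SignedLowerHalvesSmallImageLowerHalfBothSignsRttCharRoadE1LocalSquareData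
import Summits.BirchSwinnertonDyer.BirchSwinnertonDyer.Theorems.SignedLowerHalvesSmallImageLowerHalfBothSignsRttCharRoadE1TowerLayers
import Summits.BirchSwinnertonDyer.BirchSwinnertonDyer.Theorems.SignedLowerHalvesSmallImageLowerHalfBothSignsLambdaLowerThreeNsThetaPartnerPlaces
import Summits.BirchSwinnertonDyer.BirchSwinnertonDyer.Theorems.EisensteinPrimesUnramifiedOutsideRamification
import Summits.BirchSwinnertonDyer.BirchSwinnertonDyer.Theorems.SignedBaseChangeAnticyclotomicEisensteinDivisibilityCurveModel
import Literature.NumberTheory.GaloisRepresentations.RestrictedRamificationBaseChange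
import Literature.NumberTheory.EllipticCurves.HeegnerPointsKolyvaginCebotarevProofs
import Literature.NumberTheory.EllipticCurves.HeegnerPointsKolyvaginGoodReductionProofs
import Literature.NumberTheory.EllipticCurves.ZpExtensionUnramifiedProofs
import HarnessLib

/-!
# Route `SignedLowerHalves`, crux L `SmallImageLowerHalfBothSigns` (stmt-BirchSwinnertonDyer-23599), line `rtt_w3` v12 — block DESC AWAY
# FROM `p`, END TO END (GLUE memo `Lines/rtt_w3-GLUE-g7.md` §4/§5 arrow «DESC-away»): from the `K`-side layer class `y` over `Γ_{K_n}`
# unramified outside `S₀K ∪ {w ∣ p}` (the `unramifiedOutside` conjunct of the carrier `signedTransportSelmerLayerSat … S₀K ε n`), the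
# corestricted class `η = cor (e^* (subgroupH1Iso (res_= y))) ∈ H¹(Γ_{ℚ_n}, E[p^∞])` is unramified outside `S₀ ∪ {p}` — EXACTLY the
# hypothesis `hunr` of the LEAD's `…RttCharRoadE1TopPackagingCond.resOfLe_mem_acSignedSelmer_of_layer_of_condAbove`, for the SAME term `η`
# as in -w3 g17's `…RttCharRoadE1LocalAtPGlue.resOfLe_corH1_mem_condAbove_sgn` (the `p`-part).

Width seat `bsd-line-slh-p3-w3` g18 under LEAD `cruxlead-stmt-BirchSwinnertonDyer-23599` (cell `bsd-ssimc`; `--supports stmt-BirchSwinnertonDyer-23599 --as helper`).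
THEOREMS ONLY (no definition, no named fact, no instance, no `sorry`). BSD / crux L / INJ_top are NOT proved here.

THE THREE BRIDGES (g17's HANDOFF residue) and how they are discharged:
* «`inertia v ≤ galRange K` for `v ∤ disc K`» — the chosen-embedding form is the LEAD's `inertia_le_galRange_of_not_mem` (p768106, imported); here
  `primeInertia_le_galRange_of_not_dvd_discr`: EVERY inertia group `I_𝔓 ≤ Γ_ℚ` above a place `v` with `ℓ_v ∤ d_K` lies in `galRange K` (tree
  `inertia_le_range_absGaloisRestrict_of_isUnramifiedIn` + Dedekind's discriminant theorem `isUnramifiedIn_asIdeal_of_not_dvd_discr`) — needed for ALL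
  primes above `v` because the ramification subgroup `N_Σ` is generated by all of them; `not_dvd_discr_of_not_mem` derives `ℓ_v ∤ d_K` for `v ∉ S₀` from
  the stub's binders `hbad`/`hS₀bad`.
* «unramified half of the `subgroupH1Iso` transport» — `subgroupH1Iso_mem_unramifiedOutside`: for `U ≤ galRange K` closed normal containing every
  inertia group outside `Σ = S₀ ∪ {v ∣ p}`, a `K`-side class over `res⁻¹ U` unramified outside the places above `S₀` is carried by
  `subgroupH1Iso` to a class unramified outside `S₀`. Proof through the RAMIFICATION SUBGROUPS (no cocycles): Greenberg–Vatsal's place-by-place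
  condition is `ker (res : H¹(H, M) → H¹(N_Σ, M))` on both sides (tree `UnramifiedInflation.mem_unramifiedOutside_iff_resOfLe_eq_zero`, needing
  `N_Σ ≤ H`, `H` closed, `N_Σ` trivial on `E[p^∞]` — Néron–Ogg–Shafarevich, tree `smul_geomPrimaryTorsion_eq_of_mem_ramificationSubgroup`),
  `res⁻¹(N_Σ(ℚ)) = N_{Σ_K}(K)` inside `ℚ_Σ ⊇ K` (tree `comap_absGaloisRestrict_ramificationSubgroup`), and `subgroupH1Iso` commutes with
  restriction (`subgroupH1Iso_resOfLe`); the places of `K` above `Σ` are `S₀K ∪ {w ∣ p}` (`setOf_under_mem_union_eq`).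
* «`cor` of unramified is unramified» — -w3 g17's ★★ `corH1_resH1Hom_mem_unramifiedOutside` (p767858), fed by the LEAD's `inertia_le_galRange_of_not_mem`.
* ★★★ `corH1_subgroupH1Iso_mem_unramifiedOutside` — the composition, stated for the glue's literal `η`.

References: [GreenbergVatsal2000] §2 pp. 16–17, 23; [NeukirchSchmidtWingberg2008] VIII §3, I §5; [NeukirchANT1999] I §9, III (2.12);
[SilvermanAEC2009] VII.4.1; [Washington1997] Prop. 13.2; [SerreGaloisCohomology1997] I §2.4–2.5.
-/

set_option autoImplicit false
set_option linter.dupNamespace false -- D-0017: single-problem summit, the namespace repeats the problem name by design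
noncomputable section

open scoped Classical

namespace Summit.BirchSwinnertonDyer.BirchSwinnertonDyer.Theorems.SmallImageCharSignedSelmer

open NumberField IsDedekindDomain Field Rat.HeightOneSpectrum
  Literature.NumberTheory.EllipticCurves Literature.NumberTheory.GaloisRepresentations
  Literature.NumberTheory.EllipticCurves.GreenbergSelmer Literature.NumberTheory.EllipticCurves.GreenbergVatsal2000
  Summit.BirchSwinnertonDyer.Rank1Residual.Additive.BaseChange
  Summit.BirchSwinnertonDyer.BirchSwinnertonDyer.Theorems

variable (K : Type) [Field K] [NumberField K]

/-! ## §1 The places of `K` above `Σ = S₀ ∪ {v ∣ p}` -/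

/-- **The places of `K` above `S₀ ∪ {v ∣ p}` are `S₀K ∪ {w ∣ p}`**, `S₀K = {w | ∃ v ∈ S₀, ℓ_v ∈ w}` (the stub's spelling of «above `S₀`»):
`w ∩ ℤ = v ↔ ℓ_v ∈ w` (tree `under_eq_iff_natCast_primesEquiv_mem`) and `p ∈ w ∩ ℤ ↔ p ∈ w`. [cite: NeukirchANT1999, Ch. I §8 (8.2)–(8.3)] -/
theorem setOf_under_mem_union_eq (p : ℕ) (S₀ : Set (HeightOneSpectrum (𝓞 ℚ))) :
    {w : HeightOneSpectrum (𝓞 K) | w.under (𝓞 ℚ) ∈ S₀ ∪ {v | ((p : ℕ) : 𝓞 ℚ) ∈ v.asIdeal}} =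
      {w | ∃ v ∈ S₀, ((natGenerator v : ℕ) : 𝓞 K) ∈ w.asIdeal} ∪ {w | ((p : ℕ) : 𝓞 K) ∈ w.asIdeal} := by
  ext w
  simp only [Set.mem_setOf_eq, Set.mem_union]
  refine or_congr ?_ ?_
  · constructor
    · intro h
      exact ⟨w.under (𝓞 ℚ), h, (under_eq_iff_natCast_primesEquiv_mem w _).1 rfl⟩
    · rintro ⟨v, hv, hvw⟩
      rwa [(under_eq_iff_natCast_primesEquiv_mem w v).2 hvw]
  · rw [HeightOneSpectrum.under_asIdeal, Ideal.mem_comap, map_natCast]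

/-! ## §2 Bridge 1: inertia at a place unramified in `K` lies in `galRange K` -/

/-- **`I_𝔓 ≤ galRange K` for every prime `𝔓 ∣ v` with `ℓ_v ∤ d_K`** (`K/ℚ` quadratic, hence Galois): `v` is unramified in `K`
(Dedekind), so its inertia groups fix the copy of `K` inside `ℚ̄`. [cite: NeukirchANT1999, Ch. III §2 Cor. (2.12), Ch. I §9 (9.6)] -/
theorem primeInertia_le_galRange_of_not_dvd_discr (hK2 : Module.finrank ℚ K = 2) {v : HeightOneSpectrum (𝓞 ℚ)}
    (hv : ¬ ((primesEquiv v : ℕ) : ℤ) ∣ NumberField.discr K) {𝔓 : Ideal (absIntegers (𝓞 ℚ) ℚ)} (h𝔓 : 𝔓 ∈ v.primesAbove) :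
    𝔓.inertia (absoluteGaloisGroup ℚ) ≤ galRange (K := ℚ) K := by
  haveI : Algebra.IsQuadraticExtension ℚ K := ⟨hK2⟩
  intro g hg
  obtain ⟨τ, rfl⟩ := inertia_le_range_absGaloisRestrict_of_isUnramifiedIn (K := K)
    (SmallImageLambdaLowerThreeNsThetaPartner.isUnramifiedIn_asIdeal_of_not_dvd_discr (K := K) rfl hv) h𝔓 hg
  exact (mem_galRange_iff K _).2 ⟨τ, rfl⟩

/-- **`ℓ_v ∤ d_K` for `v ∉ S₀`**, from the stub's binders: every prime dividing `d_K · N` is bad for `E` (`hbad`) and every bad place lies in `S₀`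
(`hS₀bad`). [cite: SilvermanAEC2009, VII.5] -/
theorem not_dvd_discr_of_not_mem (W : WeierstrassCurve ℚ) (N : ℕ)
    (hbad : ∀ (ℓ : ℕ) [Fact ℓ.Prime], ℓ ∣ (NumberField.discr K).natAbs * N → ¬ W.HasGoodReductionAtPrime ℓ)
    (S₀ : Set (HeightOneSpectrum (𝓞 ℚ))) (hS₀bad : ∀ v : HeightOneSpectrum (𝓞 ℚ), ¬ W.HasGoodReductionAt v → v ∈ S₀)
    {v : HeightOneSpectrum (𝓞 ℚ)} (hv : v ∉ S₀) : ¬ ((primesEquiv v : ℕ) : ℤ) ∣ NumberField.discr K := by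
  intro hdvd
  have hgood : W.HasGoodReductionAt v := by
    by_contra h
    exact hv (hS₀bad v h)
  haveI := Fact.mk (primesEquiv v).2
  have hgood' : W.HasGoodReductionAtPrime (primesEquiv v) :=
    (W.hasGoodReductionAtPrime_iff_hasGoodReductionAt_ringOfIntegers v).2 hgood
  exact hbad (primesEquiv v : ℕ) (dvd_mul_of_dvd_left (Int.natCast_dvd.1 hdvd) _) hgood'

/-- **Every inertia group outside `Σ = S₀ ∪ {p}` lies in `Γ_{ℚ_n} ∩ galRange K`**: in `ker κ ≤ Γ_{ℚ_n}` since a `ℤ_p`-extension is unramified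
outside `p` (Washington 13.2, tree `ZpExtension.inertia_le_kerSubgroup_holds`), in `galRange K` by `primeInertia_le_galRange_of_not_dvd_discr`.
[cite: Washington1997, Prop. 13.2] [cite: NeukirchANT1999, Ch. III §2 Cor. (2.12)] -/
theorem inertia_le_layerSubgroup_inf_galRange (hK2 : Module.finrank ℚ K = 2) {p : ℕ} [Fact p.Prime] (κ : ZpExtension ℚ p) (n : ℕ)
    {v : HeightOneSpectrum (𝓞 ℚ)} (hpv : ((p : ℕ) : 𝓞 ℚ) ∉ v.asIdeal) (hv : ¬ ((primesEquiv v : ℕ) : ℤ) ∣ NumberField.discr K)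
    {𝔓 : Ideal (absIntegers (𝓞 ℚ) ℚ)} (h𝔓 : 𝔓 ∈ v.primesAbove) :
    𝔓.inertia (absoluteGaloisGroup ℚ) ≤ κ.layerSubgroup n ⊓ galRange (K := ℚ) K :=
  le_inf ((ZpExtension.inertia_le_kerSubgroup_holds ℚ p κ hpv h𝔓).trans (κ.kerSubgroup_le_layerSubgroup n))
    (primeInertia_le_galRange_of_not_dvd_discr K hK2 hv h𝔓)

/-! ## §3 Bridge 2: the unramified condition through `subgroupH1Iso` (via the ramification subgroups) -/

/-- **`subgroupH1Iso` carries «unramified outside the places above `S₀`» to «unramified outside `S₀`».** `E/ℚ` elliptic, `K` a number field,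
`U ≤ galRange K` closed and normal in `Γ_ℚ` containing every inertia group `I_𝔓`, `𝔓 ∣ v ∉ Σ := S₀ ∪ {v ∣ p}` (so `N_Σ ≤ U`), `S₀ ⊇` the bad places.
For `x ∈ H¹(res⁻¹ U, E_K[p^∞])` in `unramifiedOutside (res⁻¹ U) E_K[p^∞] p S₀K`, `S₀K = {w | ∃ v ∈ S₀, ℓ_v ∈ w}`:
`subgroupH1Iso x ∈ unramifiedOutside U E[p^∞] p S₀`. Proof: both conditions are «restriction to the ramification subgroup vanishes»
(`UnramifiedInflation.mem_unramifiedOutside_iff_resOfLe_eq_zero`; `N_Σ`, `N_{Σ_K}` act trivially on `E[p^∞]` by Néron–Ogg–Shafarevich), `res⁻¹(N_Σ) = N_{Σ_K}`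
(`comap_absGaloisRestrict_ramificationSubgroup`, as `N_Σ ≤ U ≤ galRange K`), and `subgroupH1Iso ∘ res = res ∘ subgroupH1Iso` (`subgroupH1Iso_resOfLe`).
[cite: GreenbergVatsal2000, §2 pp. 16–17, 23] [cite: NeukirchSchmidtWingberg2008, VIII §3] [cite: SilvermanAEC2009, Prop. VII.4.1] -/
theorem subgroupH1Iso_mem_unramifiedOutside (W : WeierstrassCurve ℚ) [W.IsElliptic] (p : ℕ) [Fact p.Prime]
    {U : Subgroup (absoluteGaloisGroup ℚ)} [U.Normal] (hU : U ≤ galRange (K := ℚ) K)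
    (hUc : IsClosed ((U : Subgroup (absoluteGaloisGroup ℚ)) : Set (absoluteGaloisGroup ℚ)))
    (S₀ : Set (HeightOneSpectrum (𝓞 ℚ))) (hS₀bad : ∀ v : HeightOneSpectrum (𝓞 ℚ), ¬ W.HasGoodReductionAt v → v ∈ S₀)
    (hI : ∀ v : HeightOneSpectrum (𝓞 ℚ), v ∉ S₀ → ((p : ℕ) : 𝓞 ℚ) ∉ v.asIdeal →
      ∀ 𝔓 ∈ v.primesAbove, 𝔓.inertia (absoluteGaloisGroup ℚ) ≤ U)
    (x : (W.baseChange K).subgroupH1 p (comapResGal K U))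
    (hx : x ∈ unramifiedOutside (comapResGal K U) ((W.baseChange K).geomPrimaryTorsion p) p
      {w : HeightOneSpectrum (𝓞 K) | ∃ v ∈ S₀, ((natGenerator v : ℕ) : 𝓞 K) ∈ w.asIdeal}) :
    subgroupH1Iso K W p hU x ∈ unramifiedOutside U (W.geomPrimaryTorsion p) p S₀ := by
  -- `Σ` and `N_Σ ≤ U` on the `ℚ`-side; `N_Σ` acts trivially on `E[p^∞]`
  set Sg : Set (HeightOneSpectrum (𝓞 ℚ)) := S₀ ∪ {v | ((p : ℕ) : 𝓞 ℚ) ∈ v.asIdeal} with hSg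
  have hNU : ramificationSubgroup ℚ Sg ≤ U :=
    SignedBaseChangeAcDivCurveModel.ramificationSubgroup_le_of_normal_of_isClosed Sg U hUc
      (fun v hv 𝔓 h𝔓 ↦ hI v (fun h ↦ hv (Or.inl h)) (fun h ↦ hv (Or.inr h)) 𝔓 h𝔓)
  have htriv : ∀ σ ∈ ramificationSubgroup ℚ Sg, ∀ m : W.geomPrimaryTorsion p, σ • m = m := fun σ hσ m ↦
    SignedBaseChangeAcDivCurveModel.smul_geomPrimaryTorsion_eq_of_mem_ramificationSubgroup W p Sg
      (fun w hw ↦ Or.inl (hS₀bad w hw)) (fun w hw ↦ Or.inr hw) hσ m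
  refine UnramifiedInflation.mem_unramifiedOutside_of_resOfLe_eq_zero hNU htriv ?_
  -- the `ℚ`-side restriction to `N_Σ` is `subgroupH1Iso` of the `K`-side restriction to `res⁻¹ N_Σ`
  change W.resOfLe p hNU (subgroupH1Iso K W p hU x) = 0
  rw [← subgroupH1Iso_resOfLe K W p hU hNU x, map_eq_zero_iff _ (subgroupH1Iso K W p (hNU.trans hU)).injective]
  -- the `K`-side: `Σ_K = S₀K ∪ {w ∣ p}`, `res⁻¹ N_Σ = N_{Σ_K} ≤ res⁻¹ U`, `N_{Σ_K}` acts trivially on `E_K[p^∞]`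
  haveI : (W.baseChange K).IsElliptic := inferInstanceAs (W.map (algebraMap ℚ K)).IsElliptic
  set S₀K : Set (HeightOneSpectrum (𝓞 K)) := {w | ∃ v ∈ S₀, ((natGenerator v : ℕ) : 𝓞 K) ∈ w.asIdeal} with hS₀K
  have hSgK : {w : HeightOneSpectrum (𝓞 K) | w.under (𝓞 ℚ) ∈ Sg} = S₀K ∪ {w | ((p : ℕ) : 𝓞 K) ∈ w.asIdeal} :=
    setOf_under_mem_union_eq K p S₀
  have hUKc : IsClosed ((comapResGal K U : Subgroup (absoluteGaloisGroup K)) : Set (absoluteGaloisGroup K)) :=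
    hUc.preimage (resGal (K := ℚ) K).continuous_toFun
  have hKS : ramificationSubgroup ℚ Sg ≤ (absGaloisRestrict ℚ K).range := fun g hg ↦ by
    obtain ⟨τ, hτ⟩ := (mem_galRange_iff K g).1 (hU (hNU hg))
    exact ⟨τ, hτ⟩
  have hcomap : comapResGal K (ramificationSubgroup ℚ Sg) = ramificationSubgroup K (S₀K ∪ {w | ((p : ℕ) : 𝓞 K) ∈ w.asIdeal}) := by
    rw [← hSgK, ← comap_absGaloisRestrict_ramificationSubgroup K Sg hKS]
    ext τ
    rw [mem_comapResGal_iff, Subgroup.mem_comap]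
    rfl
  have hNHK : ramificationSubgroup K (S₀K ∪ {w | ((p : ℕ) : 𝓞 K) ∈ w.asIdeal}) ≤ comapResGal K U := by
    rw [← hcomap]
    exact comapResGal_mono K hNU
  have htrivK : ∀ σ ∈ ramificationSubgroup K (S₀K ∪ {w | ((p : ℕ) : 𝓞 K) ∈ w.asIdeal}),
      ∀ m : (W.baseChange K).geomPrimaryTorsion p, σ • m = m := fun σ hσ m ↦
    SignedBaseChangeAcDivCurveModel.smul_geomPrimaryTorsion_eq_of_mem_ramificationSubgroup (W.baseChange K) p _
      (fun w hw ↦ by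
        by_contra hw'
        apply hw
        haveI : w.asIdeal.LiesOver (w.under (𝓞 ℚ)).asIdeal := ⟨rfl⟩
        refine hasGoodReductionAt_baseChange_of_hasGoodReductionAt_rat W (w.under (𝓞 ℚ)) w ?_
        by_contra hbadv
        exact hw' (Or.inl ⟨w.under (𝓞 ℚ), hS₀bad _ hbadv, (under_eq_iff_natCast_primesEquiv_mem w _).1 rfl⟩))
      (fun w hw ↦ Or.inr hw) hσ m
  have hres : (W.baseChange K).resOfLe p hNHK x = 0 :=
    UnramifiedInflation.resOfLe_eq_zero_of_mem_unramifiedOutside hUKc hNHK htrivK hx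
  have e1 : (W.baseChange K).resOfLe p (comapResGal_mono K hNU) =
      ((W.baseChange K).resOfLe p (le_of_eq hcomap)).comp ((W.baseChange K).resOfLe p hNHK) :=
    ((W.baseChange K).resOfLe_comp_holds p (le_of_eq hcomap) hNHK).symm
  rw [e1, AddMonoidHom.comp_apply, hres, map_zero]

/-! ## §4 DESC away from `p`, end to end, for the glue's class `η = cor (e^* (subgroupH1Iso (res_= y)))` -/

/-- ★★★ **DESC AWAY FROM `p`, END TO END.** `K/ℚ` quadratic, `p` odd, `κ` a `ℤ_p`-extension of `ℚ` with layers `Γ_{ℚ_n}`, `E/ℚ` elliptic; the stub's binders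
`hbad` (every prime of `d_K · N𝔪` is bad for `E`) and `hS₀bad` (every bad place lies in `S₀`); `e : ↥((galRange K).subgroupOf Γ_{ℚ_n}) →ₜ* ↥(Γ_{ℚ_n} ∩ galRange K)`
over `Γ_ℚ`, any transversal `c₀` (`hc`), `hN`/`hM` the openness / continuity inputs of the corestriction. For a `K`-side class `y ∈ H¹(Γ_{K_n}, E_K[p^∞])`,
`Γ_{K_n} = κ_K.layerSubgroup n`, unramified outside `S₀K ∪ {w ∣ p}` with all its conjugates (`S₀K = {w | ∃ v ∈ S₀, ℓ_v ∈ w}`, the carrier's set — the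
`unramifiedOutside` conjunct of `signedTransportSelmerLayerSat κ_K E_K[p^∞] ℤ E_K id S₀K ε n`):
`cor (e^* (subgroupH1Iso (res_= y))) ∈ unramifiedOutside (κ.layerSubgroup n) E[p^∞] p ↑S₀` — the hypothesis `hunr` of the LEAD's
`resOfLe_mem_acSignedSelmer_of_layer_of_condAbove` (`…TopPackagingCond`) for the class of -w3 g17's `resOfLe_corH1_mem_condAbove_sgn` (`…LocalAtPGlue`).
Composition: restriction along `res⁻¹(Γ_{ℚ_n} ∩ galRange K) = Γ_{K_n}` keeps the condition (`resOfLe_mem_unramifiedOutside`, p765246), bridge 2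
(`subgroupH1Iso_mem_unramifiedOutside`, with `N_Σ ≤ Γ_{ℚ_n} ∩ galRange K` by `inertia_le_layerSubgroup_inf_galRange` and `not_dvd_discr_of_not_mem`), then
-w3 g17's ★★ `corH1_resH1Hom_mem_unramifiedOutside` (p767858) with the LEAD's `inertia_le_galRange_of_not_mem` (p768106) as its `hI`.
[cite: GreenbergVatsal2000, §2 pp. 16–17, 23] [cite: NeukirchSchmidtWingberg2008, I §5, VIII §3] [cite: Washington1997, Prop. 13.2] -/
theorem corH1_subgroupH1Iso_mem_unramifiedOutside (hK2 : Module.finrank ℚ K = 2) {p : ℕ} [Fact p.Prime] (hp2 : p ≠ 2)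
    (κ : ZpExtension ℚ p) (W : WeierstrassCurve ℚ) [W.IsElliptic] (n : ℕ)
    [((galRange (K := ℚ) K).subgroupOf (κ.layerSubgroup n)).Normal]
    (𝔪 : Ideal (𝓞 K))
    (hbad : ∀ (ℓ : ℕ) [Fact ℓ.Prime], ℓ ∣ (NumberField.discr K).natAbs * Ideal.absNorm 𝔪 → ¬ W.HasGoodReductionAtPrime ℓ)
    (S₀ : Finset (HeightOneSpectrum (𝓞 ℚ)))
    (hS₀bad : ∀ v : HeightOneSpectrum (𝓞 ℚ), ¬ W.HasGoodReductionAt v → v ∈ S₀)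
    (e : ((galRange (K := ℚ) K).subgroupOf (κ.layerSubgroup n)) →ₜ*
      (κ.layerSubgroup n ⊓ galRange (K := ℚ) K : Subgroup (absoluteGaloisGroup ℚ)))
    (he : ∀ x : (galRange (K := ℚ) K).subgroupOf (κ.layerSubgroup n),
      ((e x : (κ.layerSubgroup n ⊓ galRange (K := ℚ) K : Subgroup (absoluteGaloisGroup ℚ))) : absoluteGaloisGroup ℚ) =
        ((x : κ.layerSubgroup n) : absoluteGaloisGroup ℚ))
    {c₀ : κ.layerSubgroup n}
    (hc : ∀ b : κ.layerSubgroup n, Xor (b * c₀⁻¹ ∈ (galRange (K := ℚ) K).subgroupOf (κ.layerSubgroup n))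
      (b ∈ (galRange (K := ℚ) K).subgroupOf (κ.layerSubgroup n)))
    (hN : IsOpen (((galRange (K := ℚ) K).subgroupOf (κ.layerSubgroup n) : Subgroup (κ.layerSubgroup n)) : Set (κ.layerSubgroup n)))
    (hM : ∀ m : W.geomPrimaryTorsion p, Continuous fun g : κ.layerSubgroup n ↦ g • m)
    (y : (W.baseChange K).subgroupH1 p ((κ.restrictOfFinrankEqTwo hp2 K hK2).layerSubgroup n))
    (hy : y ∈ unramifiedOutside ((κ.restrictOfFinrankEqTwo hp2 K hK2).layerSubgroup n) ((W.baseChange K).geomPrimaryTorsion p) p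
      {w : HeightOneSpectrum (𝓞 K) | ∃ v ∈ S₀, ((natGenerator v : ℕ) : 𝓞 K) ∈ w.asIdeal}) :
    corH1 hN hM hc
        (resH1Hom e (AddMonoidHom.id (W.geomPrimaryTorsion p))
          (smul_eq_smul_of_coe_eq W p (κ.layerSubgroup n) (galRange (K := ℚ) K) e he)
          (subgroupH1Iso K W p (inf_le_right : κ.layerSubgroup n ⊓ galRange (K := ℚ) K ≤ galRange (K := ℚ) K)
            ((W.baseChange K).resOfLe p (le_of_eq (comapResGal_layerSubgroup_inf_galRange hp2 κ K hK2 n)) y))) ∈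
      unramifiedOutside (κ.layerSubgroup n) (W.geomPrimaryTorsion p) p (S₀ : Set (HeightOneSpectrum (𝓞 ℚ))) := by
  haveI hUn : (galRange (K := ℚ) K).Normal := Subgroup.normal_of_index_eq_two (index_galRange_eq_two K hK2)
  haveI : (κ.layerSubgroup n ⊓ galRange (K := ℚ) K).Normal := Subgroup.normal_inf_normal _ _
  -- (1) restriction along the equality `res⁻¹(Γ_{ℚ_n} ∩ galRange K) = Γ_{K_n}` keeps the `K`-side condition
  have hx : (W.baseChange K).resOfLe p (le_of_eq (comapResGal_layerSubgroup_inf_galRange hp2 κ K hK2 n)) y ∈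
      unramifiedOutside (comapResGal K (κ.layerSubgroup n ⊓ galRange (K := ℚ) K)) ((W.baseChange K).geomPrimaryTorsion p) p
        {w : HeightOneSpectrum (𝓞 K) | ∃ v ∈ (S₀ : Set (HeightOneSpectrum (𝓞 ℚ))), ((natGenerator v : ℕ) : 𝓞 K) ∈ w.asIdeal} :=
    resOfLe_mem_unramifiedOutside (le_of_eq (comapResGal_layerSubgroup_inf_galRange hp2 κ K hK2 n)) p _ hy
  -- (2) bridge 2: through `subgroupH1Iso` (`N_Σ ≤ Γ_{ℚ_n} ∩ galRange K`: inertia outside `S₀ ∪ {p}` is in `ker κ` and in `galRange K`)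
  have hUc : IsClosed ((κ.layerSubgroup n ⊓ galRange (K := ℚ) K : Subgroup (absoluteGaloisGroup ℚ)) : Set (absoluteGaloisGroup ℚ)) :=
    Subgroup.isClosed_of_isOpen _ ((κ.isOpen_layerSubgroup n).inter (isOpen_galRange (K := ℚ) K))
  have hS₀bad' : ∀ v : HeightOneSpectrum (𝓞 ℚ), ¬ W.HasGoodReductionAt v → v ∈ (S₀ : Set (HeightOneSpectrum (𝓞 ℚ))) :=
    fun v hv ↦ Finset.mem_coe.2 (hS₀bad v hv)
  have hx' := subgroupH1Iso_mem_unramifiedOutside K W p (U := κ.layerSubgroup n ⊓ galRange (K := ℚ) K) inf_le_right hUc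
    (S₀ : Set (HeightOneSpectrum (𝓞 ℚ))) hS₀bad'
    (fun v hv hpv 𝔓 h𝔓 ↦ inertia_le_layerSubgroup_inf_galRange K hK2 κ n hpv
      (not_dvd_discr_of_not_mem K W (Ideal.absNorm 𝔪) hbad _ hS₀bad' hv) h𝔓) _ hx
  -- (3) `cor` of unramified is unramified (g17, p767858), with the LEAD's `hI` (p768106)
  exact corH1_resH1Hom_mem_unramifiedOutside (κ.layerSubgroup n) (galRange (K := ℚ) K) (W.geomPrimaryTorsion p) p
    (S₀ : Set (HeightOneSpectrum (𝓞 ℚ))) e he hN hM hc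
    (fun v hv _ ↦ inertia_le_galRange_of_not_mem W K hK2 𝔪 hbad S₀ hS₀bad hv) _ hx'

end Summit.BirchSwinnertonDyer.BirchSwinnertonDyer.Theorems.SmallImageCharSignedSelmer

end
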